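import Literature.MathematicalPhysics.QuantumFieldTheory.ConformalBootstrap3D.BlockZSeriesAB
import Mathlib.Topology.Algebra.InfiniteSum.Real
import HarnessLib

/-!
# The leading trajectory of the mixed-channel coefficients and Dolan–Osborn's leading-twist line at `d = 3`

Two closed-form facts about the general-`(a,b)` `z`-series coefficients `A_{n,j}(a,b; Δ, ℓ)` of
`MixedBlockCoefficients.lean` (`hrCoeffAB`, Dolan–Osborn 2004 §3 eqs. (3.9)–(3.12) in Hogervorst–Rychkov
normalisation, `a = -Δ₁₂/2`, `b = Δ₃₄/2`), and their consequence for genuine blocks.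

* **Leading trajectory** (`j = ℓ + n`, Dolan–Osborn's `n' = 0` family `r_{m0}`, their eq. (3.13) with the
  Pochhammer factor (3.11)): `hrCoeffAB_leading` —
  `A_{n,ℓ+n}(a,b) = ∏_{i<n} γ⁺_{Δ+i,ℓ+i}(a,b) / (C_{Δ+i+1,ℓ+i+1} - C_{Δ,ℓ})`, with the explicit factors
  `γ⁺_{Δ+i,ℓ+i}(a,b) = (Δ+ℓ+2i+2a)(Δ+ℓ+2i+2b)(ℓ+i+1)/(2ℓ+2i+1)` and pivot `2(i+1)(Δ+ℓ+i)`
  (`casimirPivot3D_leading`), i.e. `A_{n,ℓ+n} = (λ₁+a)_n (λ₁+b)_n (ℓ+1)_n / ((ℓ+½)_n n! (2λ₁)_n)`,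
  `λ₁ = (Δ+ℓ)/2`; positive as soon as `Δ + ℓ > 0` and every `(Δ+ℓ+2i+2a)(Δ+ℓ+2i+2b) > 0`
  (`hrCoeffAB_leading_pos`; automatic for `a = b` off the zeros, and for `Δ + ℓ > 2|a|` when `b = -a`).
* **The leading-twist line** `(Δ-ℓ-1+2a)(Δ-ℓ-1+2b) = 0` (`λ₂ - ½ + b = 0` or `λ₂ - ½ + a = 0`): there EVERY
  off-leading coefficient vanishes, `hrCoeffAB_eq_zero_of_line` (the first `γ⁻` step off the trajectory carries
  the factor `(Δ-ℓ-1+2a)(Δ-ℓ-1+2b)`, `hrGammaMinusAB_leading`; Dolan–Osborn 2004 eq. (3.11): the factor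
  `(λ₂-½+a)_{n'}(λ₂-½+b)_{n'}` of `r_{mn'}`), and the surviving coefficients telescope to
  `A_{n,ℓ+n} = (λ₁+a)_n (ℓ+1)_n / (n! (2λ₁)_n)` (`hrCoeffAB_leading_of_line`, product form). This is
  Dolan–Osborn 2011 §6: at `d = 3`, on `λ₂ = ½ - b` and for any `a`,
  `F_{λ₁λ₂}(a,b;x,x̄) = u^{½-b} (1/π)∫₀^π X^ℓ ₂F₁(λ₁+a, ℓ+1; 2λ₁; X) ds`, `X = x cos²s + x̄ sin²s`
  (their eqs. (6.17)–(6.20)), whose Legendre expansion via `(1/π)∫₀^π Xⁿ ds = u^{n/2} Pₙ(σ)` (their (6.13))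
  is exactly the single trajectory `Σ_n A_{n,ℓ+n} 𝒫_{Δ+n,ℓ+n}` with these coefficients.
* **Genuine blocks on the line**: `IsConformalBlock3D.hasSum_leading_of_line` — at a regular `(Δ, ℓ)` above
  the unitarity bound, every `g` with `IsConformalBlock3D Δ₁₂ Δ₃₄ Δ ℓ g` and
  `(Δ-ℓ-1-Δ₁₂)(Δ-ℓ-1+Δ₃₄) = 0` satisfies, at every real point `0 < x, y < 1`,
  `g(x,y) = Σ_n (A_{n,ℓ+n}(a,b)/λ_ℓ) 𝒫_{Δ+n,ℓ+n}(x,y)` (from `IsConformalBlock3D.hasSum_hrLevelAB`).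

For the `σ–ε` system (`MixedBlockCoefficients`): both odd-channel families `gmm = g^{Δ_σε,Δ_σε}` and
`gpm = g^{-Δ_σε,Δ_σε}` have `Δ₃₄ = Δ_σε`, so for EVERY spin `ℓ` the operators of twist
`Δ - ℓ = 1 - Δ_σε = 1 + (Δ_ε - Δ_σ)` (`≈ 1.894` near the Ising point) have one-trajectory blocks with the
closed-form coefficients above — an exact cross-check line for mixed-channel evaluators with `a ≠ 0`, and the
line on which the `n' ≥ 1` quadrants of both families change sign / vanish (pub-ising3d AXIOMS-SOURCES §8 S8.3,
R8′). Numerical companion (not part of the proofs): pub-ising3d-lit-g3 `code/check_do2011_leading_twist_line.py`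
(recursion vs. closed form vs. quadrature of (6.20), all `(a,b)` tested, agreement `1e-17`).

Nothing here is claimed AT the unitarity bound or at accidental degeneracies; the product formula itself is
unconditional (Lean's `x/0 = 0` convention on both sides).

References: F. A. Dolan, H. Osborn, Nucl. Phys. B 678 (2004) 491, §3 eqs. (3.10)–(3.13)
[cite: DolanOsborn2004, §3 eqs. (3.11), (3.13)]; F. A. Dolan, H. Osborn, *Conformal partial waves: further
mathematical results*, arXiv:1108.6194, §6 eqs. (6.13), (6.17)–(6.22) (equation numbers by the `\eqn` count of
the arXiv v2 source; TeX labels `\Leg`, `\fint`–`\Fz`) [cite: DolanOsborn2011, §6 eqs. (6.17)–(6.20)].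
-/

namespace Literature.MathematicalPhysics.QuantumFieldTheory.ConformalBootstrap3D

open Finset Set

/-! ### The pivot and the weights along the leading trajectory -/

/-- On the leading trajectory the pivot factorises: `C_{Δ+i+1,ℓ+i+1} - C_{Δ,ℓ} = 2(i+1)(Δ+ℓ+i)`
(`= 2N(2λ₁+N-1)` with `N = i+1`; Dolan–Osborn 2004 eq. (3.12), left side with `n = 0`).
[cite: DolanOsborn2004, §3 eq. (3.12)] -/
theorem casimirPivot3D_leading (Δ : ℝ) (ℓ i : ℕ) :
    casimirPivot3D Δ ℓ (i + 1) (ℓ + i + 1) = 2 * ((i : ℝ) + 1) * (Δ + ℓ + i) := by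
  unfold casimirPivot3D
  push_cast
  ring

/-- The pivot on the leading trajectory is positive as soon as `Δ + ℓ > 0`. [folklore] -/
theorem casimirPivot3D_leading_pos {Δ : ℝ} {ℓ : ℕ} (h : 0 < Δ + ℓ) (i : ℕ) :
    0 < casimirPivot3D Δ ℓ (i + 1) (ℓ + i + 1) := by
  rw [casimirPivot3D_leading]
  have hi : (0 : ℝ) ≤ i := Nat.cast_nonneg i
  have : 0 < Δ + ℓ + i := by linarith
  positivity

/-- The spin-raising weight along the trajectory:
`γ⁺_{Δ+i,ℓ+i}(a,b) = (Δ+ℓ+2i+2a)(Δ+ℓ+2i+2b)(ℓ+i+1)/(2ℓ+2i+1)` (`= 4(λ₁+i+a)(λ₁+i+b)(ℓ+i+1)/(2(ℓ+i)+1)`).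
[cite: DolanOsborn2004, §3 eq. (3.11)] -/
theorem hrGammaPlusAB_leading (a b Δ : ℝ) (ℓ i : ℕ) :
    hrGammaPlusAB a b (Δ + i) (ℓ + i) =
      (Δ + ℓ + 2 * i + 2 * a) * (Δ + ℓ + 2 * i + 2 * b) * ((ℓ : ℝ) + i + 1) / (2 * ℓ + 2 * i + 1) := by
  unfold hrGammaPlusAB
  push_cast
  ring_nf

/-- The spin-lowering weight for the first step OFF the trajectory, `(n, ℓ+n) → (n+1, ℓ+n-1)`:
`γ⁻_{Δ+n,ℓ+n}(a,b) = (Δ-ℓ-1+2a)(Δ-ℓ-1+2b)(ℓ+n)/(2(ℓ+n)+1)` — independent of the level except through the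
harmless last factor; its `(a,b)`-part is Dolan–Osborn's `(λ₂-½+a)(λ₂-½+b)`. [cite: DolanOsborn2004, §3 eq. (3.11)] -/
theorem hrGammaMinusAB_leading (a b Δ : ℝ) (ℓ n : ℕ) :
    hrGammaMinusAB a b (Δ + n) (ℓ + n) =
      (Δ - ℓ - 1 + 2 * a) * (Δ - ℓ - 1 + 2 * b) * ((ℓ : ℝ) + n) / (2 * ((ℓ : ℝ) + n) + 1) := by
  unfold hrGammaMinusAB
  push_cast
  ring_nf

/-! ### The leading trajectory in closed (product) form -/

/-- **Leading trajectory, product form** (unconditional):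
`A_{n,ℓ+n}(a,b) = ∏_{i<n} γ⁺_{Δ+i,ℓ+i}(a,b) / (C_{Δ+i+1,ℓ+i+1} - C_{Δ,ℓ})`. Proof: on the trajectory the
recursion has a single parent, `A_{n,ℓ+n+2} = 0` lying beyond the descendant range.
(Dolan–Osborn 2004 eq. (3.13) `r̂_{m0}` times the factor `(λ₁+a)_m(λ₁+b)_m` of eq. (3.11).)
[cite: DolanOsborn2004, §3 eqs. (3.11), (3.13)] -/
theorem hrCoeffAB_leading (a b Δ : ℝ) (ℓ : ℕ) :
    ∀ n : ℕ, hrCoeffAB a b Δ ℓ n (ℓ + n) =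
      ∏ i ∈ range n, hrGammaPlusAB a b (Δ + i) (ℓ + i) / casimirPivot3D Δ ℓ (i + 1) (ℓ + i + 1) := by
  intro n
  induction n with
  | zero => simp
  | succ n ih =>
    rw [prod_range_succ, ← ih, show ℓ + (n + 1) = (ℓ + n) + 1 by ring, hrCoeffAB_succ]
    have hne : ℓ + n + 1 ≠ 0 := by omega
    rw [if_neg hne, Nat.add_sub_cancel,
      hrCoeffAB_eq_zero_of_lt a b Δ (show ℓ + n < ℓ + n + 1 + 1 by omega), mul_zero, add_zero]
    ring

/-- **Leading trajectory, explicit factors**: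
`A_{n,ℓ+n}(a,b) = ∏_{i<n} (Δ+ℓ+2i+2a)(Δ+ℓ+2i+2b)(ℓ+i+1) / ((2ℓ+2i+1) · 2(i+1)(Δ+ℓ+i))`
(`= (λ₁+a)_n(λ₁+b)_n(ℓ+1)_n / ((ℓ+½)_n n! (2λ₁)_n)`). [cite: DolanOsborn2004, §3 eqs. (3.11), (3.13)] -/
theorem hrCoeffAB_leading_explicit (a b Δ : ℝ) (ℓ n : ℕ) :
    hrCoeffAB a b Δ ℓ n (ℓ + n) =
      ∏ i ∈ range n, (Δ + ℓ + 2 * i + 2 * a) * (Δ + ℓ + 2 * i + 2 * b) * ((ℓ : ℝ) + i + 1) /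
        ((2 * ℓ + 2 * i + 1) * (2 * ((i : ℝ) + 1) * (Δ + ℓ + i))) := by
  rw [hrCoeffAB_leading]
  refine prod_congr rfl fun i _ => ?_
  rw [hrGammaPlusAB_leading, casimirPivot3D_leading, div_div]

/-- **Positivity of the leading trajectory**: if `Δ + ℓ > 0` and every factor
`(Δ+ℓ+2i+2a)(Δ+ℓ+2i+2b)`, `i < n`, is positive, then `A_{n,ℓ+n}(a,b) > 0`. [cite: DolanOsborn2004, §3 eq. (3.11)] -/
theorem hrCoeffAB_leading_pos {a b Δ : ℝ} {ℓ n : ℕ} (hΔℓ : 0 < Δ + ℓ)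
    (hab : ∀ i < n, 0 < (Δ + ℓ + 2 * i + 2 * a) * (Δ + ℓ + 2 * i + 2 * b)) :
    0 < hrCoeffAB a b Δ ℓ n (ℓ + n) := by
  rw [hrCoeffAB_leading_explicit]
  refine prod_pos fun i hi => ?_
  have h1 := hab i (mem_range.mp hi)
  have hi0 : (0 : ℝ) ≤ i := Nat.cast_nonneg i
  have hℓ0 : (0 : ℝ) ≤ ℓ := Nat.cast_nonneg ℓ
  have h2 : 0 < (ℓ : ℝ) + i + 1 := by linarith
  have h3 : 0 < (2 : ℝ) * ℓ + 2 * i + 1 := by linarith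
  have h4 : 0 < 2 * ((i : ℝ) + 1) * (Δ + ℓ + i) := by
    have : 0 < Δ + ℓ + i := by linarith
    positivity
  exact div_pos (mul_pos h1 h2) (mul_pos h3 h4)

/-- For the `a = -b` family (`⟨σεσε⟩`, `Δ₁₂ = Δ₃₄`): `(Δ+ℓ+2i+2a)(Δ+ℓ+2i-2a) = (Δ+ℓ+2i)² - 4a² > 0` for all
`i` as soon as `Δ + ℓ > 2|a|` (`= |Δ₁₂|`), so the whole leading trajectory is positive; the condition fails
exactly for the exchange of `σ` itself in `σ × ε` (`ℓ = 0`, `Δ_σ < |Δ_σε|`), whose leading trajectory is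
negative from level one on (pub-ising3d AXIOMS-SOURCES S8.3, sign `s₁`). [cite: DolanOsborn2004, §3 eq. (3.11)] -/
theorem hrCoeffAB_leading_pos_of_neg {a Δ : ℝ} {ℓ : ℕ} (h : 2 * |a| < Δ + ℓ) (n : ℕ) :
    0 < hrCoeffAB a (-a) Δ ℓ n (ℓ + n) := by
  have hΔℓ : 0 < Δ + ℓ := lt_of_le_of_lt (by positivity) h
  refine hrCoeffAB_leading_pos hΔℓ fun i _ => ?_
  have hi0 : (0 : ℝ) ≤ i := Nat.cast_nonneg i
  have hlt : 2 * |a| < Δ + ℓ + 2 * i := by linarith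
  have hsq : (2 * |a|) ^ 2 < (Δ + ℓ + 2 * i) ^ 2 := by
    apply pow_lt_pow_left₀ hlt (by positivity) two_ne_zero
  have habs : (2 * |a|) ^ 2 = 4 * a ^ 2 := by rw [mul_pow, sq_abs]; ring
  have : (Δ + ℓ + 2 * i + 2 * a) * (Δ + ℓ + 2 * i + 2 * -a) = (Δ + ℓ + 2 * i) ^ 2 - 4 * a ^ 2 := by ring
  rw [this]
  linarith

/-- For `a = b` (`⟨εσσε⟩`, `Δ₁₂ = -Δ₃₄`): the leading trajectory is positive as soon as `Δ + ℓ > 0` and no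
factor `Δ+ℓ+2i+2a` vanishes. [cite: DolanOsborn2004, §3 eq. (3.11)] -/
theorem hrCoeffAB_leading_pos_of_self {a Δ : ℝ} {ℓ n : ℕ} (hΔℓ : 0 < Δ + ℓ)
    (hne : ∀ i < n, Δ + ℓ + 2 * i + 2 * a ≠ 0) : 0 < hrCoeffAB a a Δ ℓ n (ℓ + n) := by
  refine hrCoeffAB_leading_pos hΔℓ fun i hi => ?_
  have h0 := hne i hi
  have hsq : (Δ + ℓ + 2 * i + 2 * a) * (Δ + ℓ + 2 * i + 2 * a) = (Δ + ℓ + 2 * i + 2 * a) ^ 2 := by ring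
  rw [hsq]
  exact lt_of_le_of_ne (sq_nonneg _) (Ne.symm (pow_ne_zero 2 h0))

/-! ### The leading-twist line: all off-leading coefficients vanish -/

/-- **Dolan–Osborn's leading-twist line.** If `(Δ-ℓ-1+2a)(Δ-ℓ-1+2b) = 0` (i.e. `λ₂ - ½ + b = 0` or
`λ₂ - ½ + a = 0`), then every coefficient off the leading trajectory vanishes: `A_{n,j}(a,b) = 0` for
`j ≠ ℓ + n`. Proof: induction on the level — an off-trajectory coefficient has off-trajectory parents except for
the single `γ⁻` step from `(n, ℓ+n)`, whose weight is `(Δ-ℓ-1+2a)(Δ-ℓ-1+2b)(ℓ+n)/(2(ℓ+n)+1) = 0`.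
(Dolan–Osborn 2004 eq. (3.11): `r_{mn'} ∝ (λ₂-½+a)_{n'}(λ₂-½+b)_{n'}`; Dolan–Osborn 2011 §6 eq. (6.20): the
block on `λ₂ = ½ - b` is a single Legendre trajectory.) [cite: DolanOsborn2011, §6 eqs. (6.17)–(6.20)] -/
theorem hrCoeffAB_eq_zero_of_line {a b Δ : ℝ} {ℓ : ℕ}
    (hline : (Δ - ℓ - 1 + 2 * a) * (Δ - ℓ - 1 + 2 * b) = 0) :
    ∀ n j : ℕ, j ≠ ℓ + n → hrCoeffAB a b Δ ℓ n j = 0 := by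
  intro n
  induction n with
  | zero =>
    intro j hj
    exact hrCoeffAB_zero_of_ne a b Δ (by simpa using hj)
  | succ n ih =>
    intro j hj
    rw [hrCoeffAB_succ]
    have hplus : (if j = 0 then (0 : ℝ)
        else hrGammaPlusAB a b (Δ + n) (j - 1) * hrCoeffAB a b Δ ℓ n (j - 1)) = 0 := by
      split_ifs with h0
      · rfl
      · rw [ih (j - 1) (by omega), mul_zero]
    have hminus : hrGammaMinusAB a b (Δ + n) (j + 1) * hrCoeffAB a b Δ ℓ n (j + 1) = 0 := by
      by_cases hj1 : j + 1 = ℓ + n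
      · rw [hj1, hrGammaMinusAB_leading, hline]
        simp
      · rw [ih (j + 1) hj1, mul_zero]
    rw [hplus, hminus, zero_add, zero_div]

/-- On the line, the level sums reduce to the leading coefficient: `Σ_j A_{n,j} = A_{n,ℓ+n}`.
[cite: DolanOsborn2011, §6 eq. (6.20)] -/
theorem hrLevelSumAB_of_line {a b Δ : ℝ} {ℓ : ℕ}
    (hline : (Δ - ℓ - 1 + 2 * a) * (Δ - ℓ - 1 + 2 * b) = 0) (n : ℕ) :
    hrLevelSumAB a b Δ ℓ n = hrCoeffAB a b Δ ℓ n (ℓ + n) := by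
  unfold hrLevelSumAB
  rw [sum_eq_single_of_mem (ℓ + n) (mem_range.mpr (by omega))]
  intro j _ hj
  exact hrCoeffAB_eq_zero_of_line hline n j hj

/-- **On the line the surviving coefficients telescope** (`λ₂ - ½ + b = 0`, i.e. `Δ - ℓ - 1 + 2b = 0`, so that
`Δ+ℓ+2i+2b = 2ℓ+2i+1` cancels the Legendre denominator):
`A_{n,ℓ+n}(a,b) = ∏_{i<n} (Δ+ℓ+2i+2a)(ℓ+i+1) / (2(i+1)(Δ+ℓ+i)) = (λ₁+a)_n (ℓ+1)_n / (n! (2λ₁)_n)` — the Taylor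
coefficients of Dolan–Osborn 2011 eq. (6.20)'s `X^ℓ ₂F₁(λ₁+a, ℓ+1; 2λ₁; X)`. [cite: DolanOsborn2011, §6 eq. (6.20)] -/
theorem hrCoeffAB_leading_of_line {a b Δ : ℝ} {ℓ : ℕ} (hline : Δ - ℓ - 1 + 2 * b = 0) (n : ℕ) :
    hrCoeffAB a b Δ ℓ n (ℓ + n) =
      ∏ i ∈ range n, (Δ + ℓ + 2 * i + 2 * a) * ((ℓ : ℝ) + i + 1) / (2 * ((i : ℝ) + 1) * (Δ + ℓ + i)) := by
  rw [hrCoeffAB_leading_explicit]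
  refine prod_congr rfl fun i _ => ?_
  have hb : Δ + ℓ + 2 * i + 2 * b = 2 * ℓ + 2 * i + 1 := by linarith
  have hne : (2 : ℝ) * ℓ + 2 * i + 1 ≠ 0 := by positivity
  rw [hb, mul_comm ((2 : ℝ) * ℓ + 2 * i + 1) (2 * ((i : ℝ) + 1) * (Δ + ℓ + i)), ← div_div,
    mul_assoc, mul_comm ((2 : ℝ) * ℓ + 2 * i + 1), ← mul_assoc, div_div, mul_div_mul_right _ _ hne]

/-- The same with the roles of `a` and `b` exchanged (the line `Δ - ℓ - 1 + 2a = 0`; the coefficients are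
symmetric in `(a,b)`). [cite: DolanOsborn2011, §6 eq. (6.20)] -/
theorem hrCoeffAB_leading_of_line' {a b Δ : ℝ} {ℓ : ℕ} (hline : Δ - ℓ - 1 + 2 * a = 0) (n : ℕ) :
    hrCoeffAB a b Δ ℓ n (ℓ + n) =
      ∏ i ∈ range n, (Δ + ℓ + 2 * i + 2 * b) * ((ℓ : ℝ) + i + 1) / (2 * ((i : ℝ) + 1) * (Δ + ℓ + i)) := by
  rw [hrCoeffAB_leading_explicit]
  refine prod_congr rfl fun i _ => ?_
  have ha : Δ + ℓ + 2 * i + 2 * a = 2 * ℓ + 2 * i + 1 := by linarith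
  have hne : (2 : ℝ) * ℓ + 2 * i + 1 ≠ 0 := by positivity
  rw [ha, mul_comm ((2 : ℝ) * ℓ + 2 * i + 1) (Δ + ℓ + 2 * i + 2 * b), mul_comm ((2 : ℝ) * ℓ + 2 * i + 1)
    (2 * ((i : ℝ) + 1) * (Δ + ℓ + i)), ← div_div, mul_assoc, mul_comm ((2 : ℝ) * ℓ + 2 * i + 1),
    ← mul_assoc, div_div, mul_div_mul_right _ _ hne]

/-- On the line `Δ - ℓ - 1 + 2b = 0` with `Δ + ℓ > 0` and `Δ + ℓ > -2a` (so that every `λ₁ + i + a > 0`), the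
surviving coefficients are positive — for the `σ–ε` odd channel (`2b = Δ_σε`, twist `1 - Δ_σε`) this holds for
every spin and both families (`2a = ∓Δ_σε`, `|Δ_σε| < 3/2 < Δ + ℓ`). [cite: DolanOsborn2011, §6 eq. (6.20)] -/
theorem hrCoeffAB_leading_pos_of_line {a b Δ : ℝ} {ℓ : ℕ} (hline : Δ - ℓ - 1 + 2 * b = 0)
    (hΔℓ : 0 < Δ + ℓ) (ha : 0 < Δ + ℓ + 2 * a) (n : ℕ) : 0 < hrCoeffAB a b Δ ℓ n (ℓ + n) := by
  rw [hrCoeffAB_leading_of_line hline]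
  refine prod_pos fun i _ => ?_
  have hi0 : (0 : ℝ) ≤ i := Nat.cast_nonneg i
  have hℓ0 : (0 : ℝ) ≤ ℓ := Nat.cast_nonneg ℓ
  have h1 : 0 < Δ + ℓ + 2 * i + 2 * a := by linarith
  have h2 : 0 < (ℓ : ℝ) + i + 1 := by linarith
  have h3 : 0 < Δ + ℓ + i := by linarith
  positivity

/-! ### Genuine blocks on the leading-twist line -/

/-- On the line, each level of the `z`-series of a block is the single term
`(A_{n,ℓ+n}(a,b)/λ_ℓ) 𝒫_{Δ+n,ℓ+n}(x,y)`. [cite: DolanOsborn2011, §6 eqs. (6.13), (6.20)] -/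
theorem hrLevelAB_of_line {a b Δ : ℝ} {ℓ : ℕ}
    (hline : (Δ - ℓ - 1 + 2 * a) * (Δ - ℓ - 1 + 2 * b) = 0) (x y : ℝ) (n : ℕ) :
    hrLevelAB a b Δ ℓ x y n =
      hrCoeffAB a b Δ ℓ n (ℓ + n) / legendreLam ℓ * zMono (Δ + (n : ℝ)) (ℓ + n) x y := by
  unfold hrLevelAB
  rw [sum_eq_single_of_mem (ℓ + n) (mem_range.mpr (by omega))]
  · rfl
  · intro j _ hj
    unfold hrZTermAB
    simp only
    rw [hrCoeffAB_eq_zero_of_line hline n j hj, zero_div, zero_mul]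

/-- **Dolan–Osborn 2011 eq. (6.20) in the tree's language.** At a regular `(Δ, ℓ)` above the unitarity bound,
every `g` with `IsConformalBlock3D Δ₁₂ Δ₃₄ Δ ℓ g` whose parameters lie on the leading-twist line
`(Δ-ℓ-1-Δ₁₂)(Δ-ℓ-1+Δ₃₄) = 0` (`a = -Δ₁₂/2`, `b = Δ₃₄/2`) is, at every real point `0 < x, y < 1`, the
single-trajectory series `g(x,y) = Σ_n (A_{n,ℓ+n}(a,b)/λ_ℓ) 𝒫_{Δ+n,ℓ+n}(x,y)` with the closed-form coefficients
`hrCoeffAB_leading_of_line`. For the `σ–ε` odd channel (`Δ₃₄ = Δ_σε` for both `gmm` and `gpm`) this is the twist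
`Δ - ℓ = 1 - Δ_σε` for every spin. [cite: DolanOsborn2011, §6 eqs. (6.17)–(6.20)] -/
theorem IsConformalBlock3D.hasSum_leading_of_line {Δ₁₂ Δ₃₄ Δ : ℝ} {ℓ : ℕ} {g : ℝ → ℝ → ℝ}
    (hΔ : unitarityBound3D ℓ < Δ) (hreg : ¬ accidentalDegeneracy3D Δ ℓ)
    (h : IsConformalBlock3D Δ₁₂ Δ₃₄ Δ ℓ g) (hline : (Δ - ℓ - 1 - Δ₁₂) * (Δ - ℓ - 1 + Δ₃₄) = 0)
    {x y : ℝ} (hx : x ∈ Ioo (0 : ℝ) 1) (hy : y ∈ Ioo (0 : ℝ) 1) :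
    HasSum (fun n : ℕ => hrCoeffAB (-Δ₁₂ / 2) (Δ₃₄ / 2) Δ ℓ n (ℓ + n) / legendreLam ℓ *
      zMono (Δ + (n : ℝ)) (ℓ + n) x y) (g x y) := by
  have hline' : (Δ - ℓ - 1 + 2 * (-Δ₁₂ / 2)) * (Δ - ℓ - 1 + 2 * (Δ₃₄ / 2)) = 0 := by
    have : (Δ - ℓ - 1 + 2 * (-Δ₁₂ / 2)) * (Δ - ℓ - 1 + 2 * (Δ₃₄ / 2)) =
        (Δ - ℓ - 1 - Δ₁₂) * (Δ - ℓ - 1 + Δ₃₄) := by ring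
    rw [this, hline]
  have hs := h.hasSum_hrLevelAB hΔ hreg hx hy
  have hfun : hrLevelAB (-Δ₁₂ / 2) (Δ₃₄ / 2) Δ ℓ x y =
      fun n : ℕ => hrCoeffAB (-Δ₁₂ / 2) (Δ₃₄ / 2) Δ ℓ n (ℓ + n) / legendreLam ℓ *
        zMono (Δ + (n : ℝ)) (ℓ + n) x y :=
    funext fun n => hrLevelAB_of_line hline' x y n
  rwa [hfun] at hs

/-- As an equation: `g(x,y) = Σ' n, (A_{n,ℓ+n}(a,b)/λ_ℓ) 𝒫_{Δ+n,ℓ+n}(x,y)` on the line.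
[cite: DolanOsborn2011, §6 eq. (6.20)] -/
theorem IsConformalBlock3D.eq_tsum_leading_of_line {Δ₁₂ Δ₃₄ Δ : ℝ} {ℓ : ℕ} {g : ℝ → ℝ → ℝ}
    (hΔ : unitarityBound3D ℓ < Δ) (hreg : ¬ accidentalDegeneracy3D Δ ℓ)
    (h : IsConformalBlock3D Δ₁₂ Δ₃₄ Δ ℓ g) (hline : (Δ - ℓ - 1 - Δ₁₂) * (Δ - ℓ - 1 + Δ₃₄) = 0)
    {x y : ℝ} (hx : x ∈ Ioo (0 : ℝ) 1) (hy : y ∈ Ioo (0 : ℝ) 1) :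
    g x y = ∑' n : ℕ, hrCoeffAB (-Δ₁₂ / 2) (Δ₃₄ / 2) Δ ℓ n (ℓ + n) / legendreLam ℓ *
      zMono (Δ + (n : ℝ)) (ℓ + n) x y :=
  (h.hasSum_leading_of_line hΔ hreg hline hx hy).tsum_eq.symm

/-- **Every partial sum is a lower bound on the line when the trajectory is positive** — the certified
lower-bound half of an evaluator on the twist-`(1 - Δ₃₄)` line, for BOTH mixed families: hypotheses
`Δ - ℓ - 1 + Δ₃₄ = 0`, `Δ + ℓ > 0`, `Δ + ℓ > Δ₁₂` (i.e. `λ₁ + a > 0`). [cite: DolanOsborn2011, §6 eq. (6.20)] -/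
theorem IsConformalBlock3D.sum_leading_le_of_line {Δ₁₂ Δ₃₄ Δ : ℝ} {ℓ : ℕ} {g : ℝ → ℝ → ℝ}
    (hΔ : unitarityBound3D ℓ < Δ) (hreg : ¬ accidentalDegeneracy3D Δ ℓ)
    (h : IsConformalBlock3D Δ₁₂ Δ₃₄ Δ ℓ g) (hline : Δ - ℓ - 1 + Δ₃₄ = 0) (hΔℓ : 0 < Δ + ℓ)
    (ha : Δ₁₂ < Δ + ℓ) {x y : ℝ} (hx : x ∈ Ioo (0 : ℝ) 1) (hy : y ∈ Ioo (0 : ℝ) 1) (N : ℕ) :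
    ∑ n ∈ range N, hrCoeffAB (-Δ₁₂ / 2) (Δ₃₄ / 2) Δ ℓ n (ℓ + n) / legendreLam ℓ *
      zMono (Δ + (n : ℝ)) (ℓ + n) x y ≤ g x y := by
  have hline2 : (Δ - ℓ - 1 - Δ₁₂) * (Δ - ℓ - 1 + Δ₃₄) = 0 := by rw [hline, mul_zero]
  have hlineb : Δ - ℓ - 1 + 2 * (Δ₃₄ / 2) = 0 := by linarith
  have ha' : 0 < Δ + ℓ + 2 * (-Δ₁₂ / 2) := by linarith
  refine sum_le_hasSum (range N) (fun n _ => ?_) (h.hasSum_leading_of_line hΔ hreg hline2 hx hy)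
  exact mul_nonneg (div_nonneg (hrCoeffAB_leading_pos_of_line hlineb hΔℓ ha' n).le (legendreLam_pos ℓ).le)
    (zMono_nonneg _ _ hx.1.le hy.1.le)

end Literature.MathematicalPhysics.QuantumFieldTheory.ConformalBootstrap3D
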